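import Literature.AlgebraicGeometry.AbelianSchemes.AbelianSchemeKOfLFibreRankEqCard
import Literature.AlgebraicGeometry.AbelianSchemes.FibreHomPointsOfFibrePoints
import Literature.AlgebraicGeometry.AbelianSchemes.AbelianSchemeFibreHom
import Literature.AlgebraicGeometry.AbelianSchemes.PolarizationLamFinrank
import Literature.AlgebraicGeometry.Motives.AbelianVarietyPolarizationTypeAnalytic
import HarnessLib

/-!
# `|K(L)(Spec Ω̄)| = |K(Θ)| = |ker λ̄| = (∏ δᵢ)²`: the geometric count of `K(L)` is constant for `L` representing a polarisation of
# type `δ`, so `K(L) → S` is finite ÉTALE over an integral Noetherian `ℚ`-base (Mumford, *Abelian Varieties* §13, §23; MFK App. 7A)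

Layer `Literature/AlgebraicGeometry/AbelianSchemes`, namespace `Literature.AlgebraicGeometry.AbelianSchemes.AbelianSchemeOver`.
Cell `hodgecm-mathlib` (D-0151), F-DAG leaf F-2c «`K(L) → S` finite étale» — file U6 of B-p08 (g12).  ★ U5
(`AbelianSchemeKOfLFibreRankEqCard.exists_kOfL_etale_of_natCard_kOfL_eq`) left exactly one input, (B2): the number
`Nat.card (A.kOfL L hL hε (Over.mk s̄))` of geometric points of `K(L)` is the same at every geometric point `s̄` of the base.  This
file discharges (B2) BY NAME in the setting of the moduli problem — `L` representing a polarisation `λ : A → Â` of type `δ`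
([MumfordFogartyKirwan1994] Ch. 7 §2 Def. 7.2 / App. 7A) — with no Riemann–Roch and no Euler characteristic:

* §1 **`natCard_kOfL_eq_natCard_KTheta`** (any base `S`, any field-valued point `s : Spec Ω → S`) — `|K(L)(Spec Ω →_S A)| = |K(Θ)|`
  for every Cartier divisor `Θ` on the fibre `A_s` of the class of `L_s`: the bijection `P ↦ (P ↦ its point of A)` between the
  `Ω`-points of `A_s` and the `S`-morphisms `Spec Ω → A` over `s` (★ `fibrePointToLeft_injective`, ★
  `exists_points_fibrePointToLeft_eq`, [GortzWedhorn2020] (4.7.1)) matches `K(Θ)` (★ `AbelianVariety.KTheta`, [MumfordAV1970] §6)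
  with `K(L)` (★ `memKOfL_iff_mem_KTheta_of_fibrePointToLeft_eq`, [MumfordAV1970] §13 «`K(L)_k̄ = K(L_k̄)`»);
* §2 **`natCard_kOfL_eq_natCard_kerPointsAt`** — for a polarisation `pol : λ : A → Â` (★ `Polarization`) with `λ̄_s = Λ(𝒪(Θ))`
  (★ `IsLambdaOfAt`, [MumfordFogartyKirwan1994] Def. 6.2–6.3) and `L_s` of the class of `Θ`: `|K(L)(Spec Ω →_S A)| = |ker λ̄_s|`
  (★ `Polarization.mem_kerPointsAt_iff_mem_KTheta`: `K(λ̄_s) = K(Θ)` on points, [MumfordAV1970] §13 / §23);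
  **`natCard_kOfL_eq_polarizationDegree_sq`** — if moreover `pol.HasType δ` and `Ω` is algebraically closed, the count is
  `(∏ δᵢ)²` (★ `Polarization.natCard_kerPointsAt_eq_of_hasType`, [MumfordFogartyKirwan1994] App. 7A «`ker(λ) ≅ ∏ ℤ/δᵢℤ × ∏ μ_{δᵢ}`»);
* §3 **`exists_kOfL_etale_of_hasType`** — THE HEAD: over `Spec R`, `R` a Noetherian domain and a `ℚ`-algebra, for `L` of rank one
  rigidified along `ε_A` which at every geometric point is of the class of an ample `Θ` with `λ̄_s̄ = Λ(𝒪(Θ))`, `λ` a polarisation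
  of type `δ`: `K(L)` is a closed subscheme of `A`, FINITE ÉTALE over `Spec R` (★ U5 fed with §2) — the relative form of
  [MumfordAV1970] §13 (p. 123), where `K(L)` is introduced as a closed subgroup scheme, finite for `L` ample.

THEOREMS ONLY (no definition, no instance, no named fact, no `sorry`).  HC_CM is proved only modulo the 7 printed citations
until rung 0 closes; this file discharges none of them and asserts nothing about HC.

## References
* [MumfordAV1970] D. Mumford, *Abelian Varieties* (1970), §6 Application 1 (p. 60), §13 (p. 123), §23 (type of a polarisation).
* [MumfordFogartyKirwan1994] D. Mumford, J. Fogarty, F. Kirwan, *Geometric Invariant Theory*, 3rd ed. (1994), Ch. 6 §2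
  Def. 6.2–6.3 (p. 120), Ch. 7 §2 Def. 7.2, App. 7A (pp. 234–235).
* [GortzWedhorn2020] U. Görtz, T. Wedhorn, *Algebraic Geometry I*, 2nd ed. (2020), Section (4.7), (4.7.1) (p. 108).
* [GortzWedhorn2023] U. Görtz, T. Wedhorn, *Algebraic Geometry II* (2023), Prop. 27.187 and Cor. 27.63 (fibrewise étaleness).
-/

set_option autoImplicit false

noncomputable section

universe u

open CategoryTheory CategoryTheory.Limits AlgebraicGeometry

namespace Literature.AlgebraicGeometry.AbelianSchemes

namespace AbelianSchemeOver

open Literature.AlgebraicGeometry.Motives Literature.AlgebraicGeometry.AbelianVarieties Literature.AlgebraicGeometry.Modules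
open Literature.AlgebraicGeometry.ModuliOfAbelianVarieties (polarizationDegree)

/-! ### §1 `|K(L)(Spec Ω →_S A)| = |K(Θ)|` at a field-valued point -/

section KTheta

variable {S : Scheme.{u}} (A : AbelianSchemeOver S) {Ω : Type u} [Field Ω] (s : Spec (.of Ω) ⟶ S)

/-- **`|K(L)(Spec Ω → S)| = |K(Θ)|`**: for `L` of rank one on `A` rigidified along `ε_A` and a Cartier divisor `Θ` on the fibre
`A_s` of the class of `L_s`, the `S`-morphisms `Spec Ω → A` over `s` lying in `K(L)` (★ `kOfL`) are equinumerous with the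
`Ω`-points of `A_s` in `K(Θ)`: `P ↦ (Spec Ω → A_s → A)` is injective (★ `fibrePointToLeft_injective`) and onto the morphisms over
`s` (★ `exists_points_fibrePointToLeft_eq`), and carries `K(Θ)` onto `K(L)` (★ `memKOfL_homMk_iff_mem_KTheta`, ★
`memKOfL_iff_mem_KTheta_of_fibrePointToLeft_eq`). [cite: MumfordAV1970, §13 (p. 123)] [cite: GortzWedhorn2020, Section (4.7), (4.7.1) (p. 108)] -/
theorem natCard_kOfL_eq_natCard_KTheta {L : A.left.Modules} (hL : HasRank L 1)
    (hε : CechPic.pullback A.unitSection (detClass (HasRank.isFiniteLocallyFree' hL)) = 1)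
    {Θ : CartierDivisor (A.fibre s).toAbelianVariety.X.left}
    (hLΘ : CechPic.pullback (X := (A.fibre s).toAbelianVariety.X.left) (pullback.fst A.X.hom s)
      (detClass (HasRank.isFiniteLocallyFree' hL)) = Θ.cechClass) :
    Nat.card (A.kOfL L hL hε (Over.mk s)) = Nat.card ((A.fibre s).toAbelianVariety.KTheta Θ) := by
  refine (Nat.card_congr (Equiv.ofBijective
    (fun P : (A.fibre s).toAbelianVariety.KTheta Θ =>
      (⟨Over.homMk (A.fibrePointToLeft s P.1) (A.fibrePointToLeft_comp_hom s P.1),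
        (A.mem_kOfL_iff hL hε _).2 ((A.memKOfL_homMk_iff_mem_KTheta s hL P.1 hLΘ).2 P.2)⟩ :
        A.kOfL L hL hε (Over.mk s))) ⟨?_, ?_⟩)).symm
  · intro P Q h
    have h' : A.fibrePointToLeft s P.1 =
        (Over.homMk (A.fibrePointToLeft s Q.1) (A.fibrePointToLeft_comp_hom s Q.1) : Over.mk s ⟶ A.X).left :=
      congrArg (fun x : A.kOfL L hL hε (Over.mk s) => (x.1 : Over.mk s ⟶ A.X).left) h
    exact Subtype.ext (fibrePointToLeft_injective s h')
  · rintro ⟨u, hu⟩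
    obtain ⟨P, hP⟩ := A.exists_points_fibrePointToLeft_eq s u
    exact ⟨⟨P, (A.memKOfL_iff_mem_KTheta_of_fibrePointToLeft_eq s hL u P hP hLΘ).1 hu⟩,
      Subtype.ext (Over.OverMorphism.ext hP)⟩

end KTheta

/-! ### §2 With a polarisation: `|K(L)(Spec Ω →_S A)| = |ker λ̄_s| = (∏ δᵢ)²` -/

section Polarization

variable {S : Scheme.{u}} (A : AbelianSchemeOver S) {D : A.DualPair} (pol : A.Polarization D)
  {Ω : Type u} [Field Ω] (s : Spec (.of Ω) ⟶ S)

/-- **`|K(L)(Spec Ω → S)| = |ker λ̄_s|`** for a polarisation `λ : A → Â` with `λ̄_s = Λ(𝒪(Θ))` at `s` (★ `IsLambdaOfAt`) and `L`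
of rank one, rigidified, with `L_s` of the class of `Θ`: §1 and `K(λ̄_s) = K(Θ)` on `Ω`-points (★
`Polarization.mem_kerPointsAt_iff_mem_KTheta`). [cite: MumfordAV1970, §13 (p. 123)]
[cite: MumfordFogartyKirwan1994, Ch. 6 §2 Definition 6.2–6.3 (p. 120)] -/
theorem natCard_kOfL_eq_natCard_kerPointsAt {L : A.left.Modules} (hL : HasRank L 1)
    (hε : CechPic.pullback A.unitSection (detClass (HasRank.isFiniteLocallyFree' hL)) = 1)
    {Θ : CartierDivisor (A.fibre s).toAbelianVariety.X.left} (hlam : A.IsLambdaOfAt s D pol.lam Θ)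
    (hLΘ : CechPic.pullback (X := (A.fibre s).toAbelianVariety.X.left) (pullback.fst A.X.hom s)
      (detClass (HasRank.isFiniteLocallyFree' hL)) = Θ.cechClass) :
    Nat.card (A.kOfL L hL hε (Over.mk s)) = Nat.card (pol.kerPointsAt s) := by
  rw [A.natCard_kOfL_eq_natCard_KTheta s hL hε hLΘ]
  exact Nat.card_congr (Equiv.subtypeEquivRight fun P => (pol.mem_kerPointsAt_iff_mem_KTheta s hlam P).symm)

/-- **`|K(L)(Spec Ω̄ → S)| = (∏ δᵢ)²`** when moreover `λ` has type `δ` (★ `Polarization.HasType`) and `Ω` is algebraically closed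
(★ `Polarization.natCard_kerPointsAt_eq_of_hasType`: `|ker λ̄_s̄| = (∏ δᵢ)²`) — the geometric count of `K(L)` is CONSTANT along the
base. [cite: MumfordFogartyKirwan1994, App. 7A (pp. 234–235)] [cite: MumfordAV1970, §23 (type of a polarisation)] -/
theorem natCard_kOfL_eq_polarizationDegree_sq [IsAlgClosed Ω] {g : ℕ} {δ : Fin g → ℕ} (hT : pol.HasType δ)
    {L : A.left.Modules} (hL : HasRank L 1)
    (hε : CechPic.pullback A.unitSection (detClass (HasRank.isFiniteLocallyFree' hL)) = 1)
    {Θ : CartierDivisor (A.fibre s).toAbelianVariety.X.left} (hlam : A.IsLambdaOfAt s D pol.lam Θ)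
    (hLΘ : CechPic.pullback (X := (A.fibre s).toAbelianVariety.X.left) (pullback.fst A.X.hom s)
      (detClass (HasRank.isFiniteLocallyFree' hL)) = Θ.cechClass) :
    Nat.card (A.kOfL L hL hε (Over.mk s)) = polarizationDegree δ ^ 2 := by
  rw [A.natCard_kOfL_eq_natCard_kerPointsAt pol s hL hε hlam hLΘ]
  exact pol.natCard_kerPointsAt_eq_of_hasType hT Ω s

end Polarization

/-! ### §3 The head: `K(L) → Spec R` is finite étale for `L` representing a polarisation of type `δ` -/

section Head

variable {R : Type} [CommRing R] (A : AbelianSchemeOver (Spec (.of R)))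

/-- **`K(L) → S` IS FINITE ÉTALE for `L` representing a polarisation of type `δ`** over `S = Spec R`, `R` a Noetherian domain and a
`ℚ`-algebra: for `L` of rank one on `A` rigidified along `ε_A` (`hε`), a polarisation `λ : A → Â` of type `δ` (★ `Polarization`,
★ `HasType`), and at every geometric point `s̄` an ample `Θ` on `A_s̄` with `λ̄_s̄ = Λ(𝒪(Θ))` and `L_s̄` of the class of `Θ` («`λ` is
`Λ(L)` fibrewise», [MumfordFogartyKirwan1994] Def. 6.3), there is a closed subscheme `K(L) ↪ A`, finite and ÉTALE over `Spec R`,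
representing `u ↦ u ∈ K(L)`.  ★ U5 `exists_kOfL_etale_of_natCard_kOfL_eq` (closed and finite: the relative seesaw engine, [MumfordAV1970]
§10/§13; unramified: Deligne/Cartier in characteristic `0`; flat: constant fibre rank over a reduced base, [Hartshorne1977] II Ex. 5.8)
with its one input — the constancy of the geometric count — supplied by §2: the count is `(∏ δᵢ)²` everywhere.
[cite: MumfordAV1970, §13 (p. 123) and §23] [cite: MumfordFogartyKirwan1994, App. 7A (pp. 234–235)]
[cite: GortzWedhorn2023, Prop. 27.187 and Cor. 27.63] -/
theorem exists_kOfL_etale_of_hasType [IsDomain R] [IsNoetherianRing R] [Algebra ℚ R] {D : A.DualPair}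
    (pol : A.Polarization D) {g : ℕ} {δ : Fin g → ℕ} (hT : pol.HasType δ) {L : A.left.Modules} (hL : HasRank L 1)
    (hε : CechPic.pullback A.unitSection (detClass (HasRank.isFiniteLocallyFree' hL)) = 1)
    (hLlam : ∀ ⦃Ω : Type⦄ [Field Ω] [IsAlgClosed Ω] (s : Spec (.of Ω) ⟶ Spec (.of R)),
      ∃ Θ : CartierDivisor (A.fibre s).toAbelianVariety.X.left, Θ.IsAmple ∧ A.IsLambdaOfAt s D pol.lam Θ ∧
        CechPic.pullback (X := (A.fibre s).toAbelianVariety.X.left) (pullback.fst A.X.hom s)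
          (detClass (HasRank.isFiniteLocallyFree' hL)) = Θ.cechClass) :
    ∃ (Z : Over (Spec (.of R))) (i : Z ⟶ A.X) (_ : IsClosedImmersion i.left) (_ : IsFinite Z.hom) (_ : Etale Z.hom),
      ∀ (T : Over (Spec (.of R))) (u : T ⟶ A.X), (∃ v : T ⟶ Z, v ≫ i = u) ↔ A.MemKOfL L u :=
  A.exists_kOfL_etale_of_natCard_kOfL_eq hL hε
    (fun Ω _ _ s => by
      obtain ⟨Θ, hΘa, -, hLΘ⟩ := hLlam s
      exact ⟨Θ, hΘa, hLΘ⟩)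
    (polarizationDegree δ ^ 2) fun Ω _ _ s => by
      obtain ⟨Θ, -, hlam, hLΘ⟩ := hLlam s
      exact A.natCard_kOfL_eq_polarizationDegree_sq pol s hT hL hε hlam hLΘ

end Head

end AbelianSchemeOver

end Literature.AlgebraicGeometry.AbelianSchemes

end
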